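import Mathlib.Data.Real.Basic
import Mathlib.Data.Rat.Cast.Order
import Mathlib.Algebra.BigOperators.Group.List.Basic
import Mathlib.Algebra.Order.BigOperators.Group.List
import Mathlib.Tactic.Ring
import Mathlib.Tactic.Linarith
import Mathlib.Tactic.Positivity
import HarnessLib

/-!
# Sparse quadratic polynomials over `ℚ` in countably many variables (`QuadCert`, part 1)

Topic `Literature/Analysis/ValidatedNumerics`.  The polynomial layer of the tree's checker for DEGREE-TWO
POSITIVSTELLENSATZ CERTIFICATES (`QuadCertTree.lean`): a quadratic real-polynomial inequality `f ≥ 0` on a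
basic semialgebraic set `{x : gᵢ(x) ≥ 0, hⱼ(x) = 0}` is certified by an explicit identity
`f = Σ λᵢ gᵢ + Σ μⱼ hⱼ + Σ κ_ab ℓ_a ℓ_b + Σ d_m (ℓ'_m)² + c` with `λ, κ, d, c ≥ 0`, `μⱼ` affine, `ℓ` linear
facts — the Lasserre / Shor relaxation of order one in certificate form [cite: Lasserre2001, Thm 4.2], checked by
exact rational arithmetic (`native_decide`).  This file is pure bookkeeping [folklore]:

* `QPoly` — a constant, a list of linear terms `(i, a) ↦ a·xᵢ` and a list of quadratic terms
  `(i, j, b) ↦ b·xᵢxⱼ` (duplicates allowed, no invariant), with real evaluation `QPoly.eval x p` at `x : ℕ → ℝ`;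
* arithmetic that is EXACT on evaluations: `add`, `smul`, `neg`, `sub`, the product `mulAff` of two AFFINE
  polynomials (`eval_mulAff`), `sq`;
* the zero test `QPoly.isZero` (sort the terms by their variable key, merge equal keys, compare all coefficients
  with `0`) and its soundness `eval_eq_zero_of_isZero` — the only place where a syntactic computation is tied to
  the semantics; completeness is irrelevant (a certificate that fails the test is simply rejected).

No analysis, no facts, no axioms; everything is computable and structurally recursive.

## References
* J. B. Lasserre, *Global optimization with polynomials and the problem of moments*, SIAM J. Optim. 11 (2001),
  Thm 4.2 (Positivstellensatz certificates of polynomial nonnegativity on basic semialgebraic sets). [cite: Lasserre2001, Thm 4.2]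
* R. E. Moore, *Interval Analysis* (1966), §4.4 — the role model for "certificate = data, checker = exact
  arithmetic" in this directory. [cite: Moore1966, §4.4]
-/

namespace Literature.Analysis.ValidatedNumerics

/-- A sparse polynomial of degree `≤ 2` over `ℚ` in variables `x₀, x₁, …`: constant `c`, linear terms
`(i, a)` meaning `a · xᵢ`, quadratic terms `(i, j, b)` meaning `b · xᵢ · xⱼ`.  Duplicate keys are allowed
(they add up under `eval`). [folklore] -/
structure QPoly where
  /-- constant term -/
  c : ℚ := 0
  /-- linear terms `a · xᵢ` -/
  lin : List (ℕ × ℚ) := []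
  /-- quadratic terms `b · xᵢ · xⱼ` -/
  quad : List (ℕ × ℕ × ℚ) := []
  deriving DecidableEq, Repr, Inhabited

namespace QPoly

/-! ### Evaluation -/

/-- Value of a list of linear terms at `x`. [folklore] -/
def linEval (x : ℕ → ℝ) (l : List (ℕ × ℚ)) : ℝ := (l.map fun ia => (ia.2 : ℝ) * x ia.1).sum

/-- Value of a list of quadratic terms at `x`. [folklore] -/
def quadEval (x : ℕ → ℝ) (q : List (ℕ × ℕ × ℚ)) : ℝ :=
  (q.map fun e => (e.2.2 : ℝ) * (x e.1 * x e.2.1)).sum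

/-- Real value of a `QPoly` at `x : ℕ → ℝ`. [folklore] -/
def eval (x : ℕ → ℝ) (p : QPoly) : ℝ := (p.c : ℝ) + linEval x p.lin + quadEval x p.quad

variable (x : ℕ → ℝ)

/-- `linEval_nil` (evaluation bookkeeping). [folklore] -/
@[simp] theorem linEval_nil : linEval x [] = 0 := by simp [linEval]

/-- `linEval_cons` (evaluation bookkeeping). [folklore] -/
@[simp] theorem linEval_cons (t : ℕ × ℚ) (l : List (ℕ × ℚ)) :
    linEval x (t :: l) = (t.2 : ℝ) * x t.1 + linEval x l := by simp [linEval]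

/-- `linEval_append` (evaluation bookkeeping). [folklore] -/
@[simp] theorem linEval_append (l m : List (ℕ × ℚ)) : linEval x (l ++ m) = linEval x l + linEval x m := by
  simp [linEval, List.sum_append]

/-- `quadEval_nil` (evaluation bookkeeping). [folklore] -/
@[simp] theorem quadEval_nil : quadEval x [] = 0 := by simp [quadEval]

/-- `quadEval_cons` (evaluation bookkeeping). [folklore] -/
@[simp] theorem quadEval_cons (t : ℕ × ℕ × ℚ) (q : List (ℕ × ℕ × ℚ)) :
    quadEval x (t :: q) = (t.2.2 : ℝ) * (x t.1 * x t.2.1) + quadEval x q := by simp [quadEval]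

/-- `quadEval_append` (evaluation bookkeeping). [folklore] -/
@[simp] theorem quadEval_append (q r : List (ℕ × ℕ × ℚ)) :
    quadEval x (q ++ r) = quadEval x q + quadEval x r := by
  simp [quadEval, List.sum_append]

/-! ### Constructors -/

/-- The constant polynomial. [folklore] -/
def const (a : ℚ) : QPoly := ⟨a, [], []⟩

/-- `eval_const` (evaluation bookkeeping). [folklore] -/
@[simp] theorem eval_const (a : ℚ) : eval x (const a) = a := by simp [eval, const]

/-- The variable `xᵢ`. [folklore] -/
def var (i : ℕ) : QPoly := ⟨0, [(i, 1)], []⟩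

/-- `eval_var` (evaluation bookkeeping). [folklore] -/
@[simp] theorem eval_var (i : ℕ) : eval x (var i) = x i := by simp [eval, var]

/-! ### Arithmetic (exact on evaluations) -/

/-- Sum. [folklore] -/
def add (p q : QPoly) : QPoly := ⟨p.c + q.c, p.lin ++ q.lin, p.quad ++ q.quad⟩

/-- `eval_add` (evaluation bookkeeping). [folklore] -/
@[simp] theorem eval_add (p q : QPoly) : eval x (add p q) = eval x p + eval x q := by
  simp only [eval, add, linEval_append, quadEval_append, Rat.cast_add]; ring

/-- Scalar multiple. [folklore] -/
def smul (a : ℚ) (p : QPoly) : QPoly :=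
  ⟨a * p.c, p.lin.map fun ib => (ib.1, a * ib.2), p.quad.map fun e => (e.1, e.2.1, a * e.2.2)⟩

/-- `linEval_map_smul` (evaluation bookkeeping). [folklore] -/
theorem linEval_map_smul (a : ℚ) (l : List (ℕ × ℚ)) :
    linEval x (l.map fun ib => (ib.1, a * ib.2)) = (a : ℝ) * linEval x l := by
  induction l with
  | nil => simp
  | cons t l ih => simp only [List.map_cons, linEval_cons, ih, Rat.cast_mul]; ring

/-- `quadEval_map_smul` (evaluation bookkeeping). [folklore] -/
theorem quadEval_map_smul (a : ℚ) (q : List (ℕ × ℕ × ℚ)) :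
    quadEval x (q.map fun e => (e.1, e.2.1, a * e.2.2)) = (a : ℝ) * quadEval x q := by
  induction q with
  | nil => simp
  | cons t q ih => simp only [List.map_cons, quadEval_cons, ih, Rat.cast_mul]; ring

/-- `eval_smul` (evaluation bookkeeping). [folklore] -/
@[simp] theorem eval_smul (a : ℚ) (p : QPoly) : eval x (smul a p) = (a : ℝ) * eval x p := by
  simp only [eval, smul, linEval_map_smul, quadEval_map_smul, Rat.cast_mul]; ring

/-- Negation. [folklore] -/
def neg (p : QPoly) : QPoly := smul (-1) p

/-- `eval_neg` (evaluation bookkeeping). [folklore] -/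
@[simp] theorem eval_neg (p : QPoly) : eval x (neg p) = -eval x p := by simp [neg]

/-- Difference. [folklore] -/
def sub (p q : QPoly) : QPoly := add p (neg q)

/-- `eval_sub` (evaluation bookkeeping). [folklore] -/
@[simp] theorem eval_sub (p q : QPoly) : eval x (sub p q) = eval x p - eval x q := by
  simp [sub, sub_eq_add_neg]

/-- Sum of a list of polynomials. [folklore] -/
def sum : List QPoly → QPoly
  | [] => const 0
  | p :: ps => add p (sum ps)

/-- `eval_sum` (evaluation bookkeeping). [folklore] -/
@[simp] theorem eval_sum (ps : List QPoly) : eval x (sum ps) = (ps.map (eval x)).sum := by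
  induction ps with
  | nil => simp [sum]
  | cons p ps ih => simp [sum, ih]

/-- A polynomial is affine when it has no quadratic terms. [folklore] -/
def isAff (p : QPoly) : Bool := p.quad.isEmpty

/-- `eval_of_isAff` (evaluation bookkeeping). [folklore] -/
theorem eval_of_isAff {p : QPoly} (h : p.isAff = true) : eval x p = (p.c : ℝ) + linEval x p.lin := by
  have : p.quad = [] := List.isEmpty_iff.mp h
  simp [eval, this]

/-- Linear terms times linear terms: all products `(i, j, a·b)`. [folklore] -/
def linMul (l m : List (ℕ × ℚ)) : List (ℕ × ℕ × ℚ) :=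
  l.flatMap fun ia => m.map fun jb => (ia.1, jb.1, ia.2 * jb.2)

/-- `quadEval_map_mul` (evaluation bookkeeping). [folklore] -/
theorem quadEval_map_mul (i : ℕ) (a : ℚ) (m : List (ℕ × ℚ)) :
    quadEval x (m.map fun jb => (i, jb.1, a * jb.2)) = (a : ℝ) * x i * linEval x m := by
  induction m with
  | nil => simp
  | cons s m ihm => simp only [List.map_cons, quadEval_cons, linEval_cons, ihm, Rat.cast_mul]; ring

/-- `quadEval_linMul` (evaluation bookkeeping). [folklore] -/
theorem quadEval_linMul (l m : List (ℕ × ℚ)) : quadEval x (linMul l m) = linEval x l * linEval x m := by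
  induction l with
  | nil => simp [linMul]
  | cons t l ih =>
    simp only [linMul, List.flatMap_cons] at ih ⊢
    rw [quadEval_append, ih, linEval_cons, add_mul, quadEval_map_mul]

/-- Product of two AFFINE polynomials (quadratic terms of the inputs are IGNORED; use only under `isAff`). [folklore] -/
def mulAff (p q : QPoly) : QPoly :=
  ⟨p.c * q.c, (p.lin.map fun ib => (ib.1, q.c * ib.2)) ++ (q.lin.map fun ib => (ib.1, p.c * ib.2)),
    linMul p.lin q.lin⟩

/-- `eval_mulAff` (evaluation bookkeeping). [folklore] -/
theorem eval_mulAff {p q : QPoly} (hp : p.isAff = true) (hq : q.isAff = true) :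
    eval x (mulAff p q) = eval x p * eval x q := by
  rw [eval_of_isAff x hp, eval_of_isAff x hq]
  simp only [eval, mulAff, linEval_append, linEval_map_smul, quadEval_linMul, Rat.cast_mul]
  ring

/-- Square of an affine polynomial. [folklore] -/
def sqAff (p : QPoly) : QPoly := mulAff p p

/-- `eval_sqAff` (evaluation bookkeeping). [folklore] -/
theorem eval_sqAff {p : QPoly} (hp : p.isAff = true) : eval x (sqAff p) = eval x p ^ 2 := by
  rw [sqAff, eval_mulAff x hp hp, sq]

/-- `eval_sqAff_nonneg` (evaluation bookkeeping). [folklore] -/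
theorem eval_sqAff_nonneg {p : QPoly} (hp : p.isAff = true) : 0 ≤ eval x (sqAff p) := by
  rw [eval_sqAff x hp]; positivity

/-! ### The zero test -/

/-- Merge adjacent linear terms with the same variable. [folklore] -/
def mergeLin : List (ℕ × ℚ) → List (ℕ × ℚ)
  | [] => []
  | [t] => [t]
  | t :: s :: l => if t.1 = s.1 then mergeLin ((t.1, t.2 + s.2) :: l) else t :: mergeLin (s :: l)
  termination_by l => l.length

/-- `linEval_mergeLin` (evaluation bookkeeping). [folklore] -/
theorem linEval_mergeLin : ∀ l : List (ℕ × ℚ), linEval x (mergeLin l) = linEval x l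
  | [] => by simp [mergeLin]
  | [t] => by simp [mergeLin]
  | t :: s :: l => by
    rw [mergeLin]
    split_ifs with h
    · rw [linEval_mergeLin ((t.1, t.2 + s.2) :: l)]
      simp only [linEval_cons, Rat.cast_add, h]; ring
    · simp only [linEval_cons, linEval_mergeLin (s :: l)]
  termination_by l => l.length

/-- Normalise a quadratic key to `i ≤ j`. [folklore] -/
def qkey (e : ℕ × ℕ × ℚ) : ℕ × ℕ × ℚ := (min e.1 e.2.1, max e.1 e.2.1, e.2.2)

/-- `quadEval_map_qkey` (evaluation bookkeeping). [folklore] -/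
theorem quadEval_map_qkey (q : List (ℕ × ℕ × ℚ)) : quadEval x (q.map qkey) = quadEval x q := by
  induction q with
  | nil => simp
  | cons t q ih =>
    simp only [List.map_cons, quadEval_cons, ih, qkey]
    rcases le_total t.1 t.2.1 with h | h
    · rw [min_eq_left h, max_eq_right h]
    · rw [min_eq_right h, max_eq_left h, mul_comm (x t.2.1)]

/-- Merge adjacent quadratic terms with the same key. [folklore] -/
def mergeQuad : List (ℕ × ℕ × ℚ) → List (ℕ × ℕ × ℚ)
  | [] => []
  | [t] => [t]
  | t :: s :: l =>
    if t.1 = s.1 ∧ t.2.1 = s.2.1 then mergeQuad ((t.1, t.2.1, t.2.2 + s.2.2) :: l) else t :: mergeQuad (s :: l)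
  termination_by l => l.length

/-- `quadEval_mergeQuad` (evaluation bookkeeping). [folklore] -/
theorem quadEval_mergeQuad : ∀ q : List (ℕ × ℕ × ℚ), quadEval x (mergeQuad q) = quadEval x q
  | [] => by simp [mergeQuad]
  | [t] => by simp [mergeQuad]
  | t :: s :: l => by
    rw [mergeQuad]
    split_ifs with h
    · rw [quadEval_mergeQuad ((t.1, t.2.1, t.2.2 + s.2.2) :: l)]
      simp only [quadEval_cons, Rat.cast_add, h.1, h.2]; ring
    · simp only [quadEval_cons, quadEval_mergeQuad (s :: l)]
  termination_by q => q.length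

/-- Sorted, merged linear terms. [folklore] -/
def normLin (l : List (ℕ × ℚ)) : List (ℕ × ℚ) := mergeLin (l.mergeSort fun a b => a.1 ≤ b.1)

/-- Sorted, merged, key-normalised quadratic terms. [folklore] -/
def normQuad (q : List (ℕ × ℕ × ℚ)) : List (ℕ × ℕ × ℚ) :=
  mergeQuad ((q.map qkey).mergeSort fun a b => a.1 < b.1 ∨ (a.1 = b.1 ∧ a.2.1 ≤ b.2.1))

/-- `linEval_perm` (evaluation bookkeeping). [folklore] -/
theorem linEval_perm {l m : List (ℕ × ℚ)} (h : l.Perm m) : linEval x l = linEval x m :=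
  (h.map _).sum_eq

/-- `quadEval_perm` (evaluation bookkeeping). [folklore] -/
theorem quadEval_perm {q r : List (ℕ × ℕ × ℚ)} (h : q.Perm r) : quadEval x q = quadEval x r :=
  (h.map _).sum_eq

/-- `linEval_normLin` (evaluation bookkeeping). [folklore] -/
theorem linEval_normLin (l : List (ℕ × ℚ)) : linEval x (normLin l) = linEval x l := by
  rw [normLin, linEval_mergeLin, linEval_perm x (List.mergeSort_perm _ _)]

/-- `quadEval_normQuad` (evaluation bookkeeping). [folklore] -/
theorem quadEval_normQuad (q : List (ℕ × ℕ × ℚ)) : quadEval x (normQuad q) = quadEval x q := by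
  rw [normQuad, quadEval_mergeQuad, quadEval_perm x (List.mergeSort_perm _ _), quadEval_map_qkey]

/-- Normal form (same evaluation). [folklore] -/
def norm (p : QPoly) : QPoly := ⟨p.c, normLin p.lin, normQuad p.quad⟩

/-- `eval_norm` (evaluation bookkeeping). [folklore] -/
@[simp] theorem eval_norm (p : QPoly) : eval x (norm p) = eval x p := by
  simp [eval, norm, linEval_normLin, quadEval_normQuad]

/-- **The zero test**: after normalisation every coefficient is `0`. [folklore] -/
def isZero (p : QPoly) : Bool :=
  decide (p.c = 0) && (normLin p.lin).all (fun t => decide (t.2 = 0)) &&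
    (normQuad p.quad).all (fun t => decide (t.2.2 = 0))

/-- `linEval_eq_zero_of_all` (evaluation bookkeeping). [folklore] -/
theorem linEval_eq_zero_of_all {l : List (ℕ × ℚ)} (h : l.all (fun t => decide (t.2 = 0)) = true) :
    linEval x l = 0 := by
  induction l with
  | nil => simp
  | cons t l ih =>
    simp only [List.all_cons, Bool.and_eq_true, decide_eq_true_eq] at h
    rw [linEval_cons, ih h.2, h.1]; simp

/-- `quadEval_eq_zero_of_all` (evaluation bookkeeping). [folklore] -/
theorem quadEval_eq_zero_of_all {q : List (ℕ × ℕ × ℚ)} (h : q.all (fun t => decide (t.2.2 = 0)) = true) :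
    quadEval x q = 0 := by
  induction q with
  | nil => simp
  | cons t q ih =>
    simp only [List.all_cons, Bool.and_eq_true, decide_eq_true_eq] at h
    rw [quadEval_cons, ih h.2, h.1]; simp

/-- **Soundness of the zero test.** [folklore] -/
theorem eval_eq_zero_of_isZero {p : QPoly} (h : p.isZero = true) (x : ℕ → ℝ) : eval x p = 0 := by
  simp only [isZero, Bool.and_eq_true, decide_eq_true_eq] at h
  obtain ⟨⟨hc, hl⟩, hq⟩ := h
  rw [← eval_norm, eval, norm]
  simp only
  rw [hc, linEval_eq_zero_of_all x hl, quadEval_eq_zero_of_all x hq]; simp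

/-- Two polynomials with the same normal form... we only need: `isZero (sub p q)` implies equal values. [folklore] -/
theorem eval_eq_of_isZero_sub {p q : QPoly} (h : (sub p q).isZero = true) (x : ℕ → ℝ) :
    eval x p = eval x q := by
  have := eval_eq_zero_of_isZero h x
  rw [eval_sub] at this; linarith

end QPoly

end Literature.Analysis.ValidatedNumerics
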